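import Summits.QuantumAdvantage.QuantumAdvantage.Theses.RegulatorThird
import Literature.Computability.Complexity.ProbabilisticClassesProofs
import Literature.Computability.Complexity.ReductionsProofs
import Literature.Computability.Complexity.StringCopy
import Literature.Computability.Complexity.StringEquality
import Literature.Computability.Complexity.StackBricks
import Literature.Computability.Complexity.StackBricksArith
import Literature.Computability.Complexity.StackArith
import Literature.Computability.Complexity.NatSqrtFP
import Literature.Computability.Complexity.PRelHierarchy
import Literature.Computability.Complexity.CHFunctions
import Literature.Computability.Complexity.BranchingFn
import Literature.Computability.Complexity.CookReducibilityTransitive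

/-!
# Refutation of `RegulatorThird.ThirdNotBPP` (stmt-QuantumAdvantage-15712)

The target `ThirdNotBPP` says that the language THIRD — pairs `⟨bin D, w⟩` with `D > 1`
non-square and `w` a prefix of the code of the LEAST triple `(A*, B*, n*)` representing the
fundamental unit of `ℚ(√s)` modulo cubes — is not in `BPP`. The inlined "representative" clause
reads `∃ z : K, (A + B·α)/n = u·z³ ∨ (A + B·α)/n = u⁻¹·z³` with NO condition `z ≠ 0`. Taking
`z = 0` makes `(A, B, n) = (0, 0, 1)` a representative for every `D` (both sides are `0`), and its
key `|A| + |B| + n = 1` is the least possible, so the least triple is ALWAYS `(0, 0, 1)`.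
Hence THIRD is the language `{⟨bin D, w⟩ : D non-square, 1 < D, w <+: code(0,0,1)}`, which is in
`P` (pair/canonicity tests, `⌊√D⌋² < D` by the tree's `natSqrt`/`prodFn`/`ltFn` bricks, a
comparison with `1`, and finitely many equality tests for the prefix clause), hence in `BPP`
(`P_subset_BPP_holds`). So `ThirdNotBPP` is false as stated.

Class: refuted-misstated. Repaired statement C′: in every one of the seven decls of the route
replace `∃ z : K, (… ∨ …)` by `∃ z : K, z ≠ 0 ∧ (… ∨ …)` (membership in `η·K^{×3} ∪ η⁻¹·K^{×3}`,
as the thesis intends); the witness `(0, 0, 1)` then is no longer a representative (`u·z³ ≠ 0`),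
so it misses C′. Everything is proved inside the single refutation theorem (no auxiliary
declarations). Route review 2026-08-16, refuter-rreview-0816T15-2-0.

Record (2026-08-16, dependency-drift repair). The route was repaired at rev 2 (17:00Z): the refuted
decl `Theses.RegulatorThird.ThirdNotBPP` was REPLACED by the corrected `ThirdNotBPPR` (clause
`∃ z : K, z ≠ 0 ∧ (… ∨ …)`, item stmt-QuantumAdvantage-15981) and no constant named `ThirdNotBPP` exists
any more (the refuted item stmt-QuantumAdvantage-15712 stays in the negatives index, served by this
module @ b65922813997). To keep the refutation theorem letter for letter (Theorems files are
append-only) without declaring a proposition in a Theorems file, the token `ThirdNotBPP` below is a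
file-LOCAL NOTATION expanding to the statement of the refuted item, verbatim from its ledger signature;
the elaborated type of `RegulatorThirdThirdNotBPP_refuted` therefore carries the refuted statement
itself, and its proof is unchanged. The notation is invisible outside this file.
-/

set_option linter.dupNamespace false

open Computability
open Literature.Computability.Complexity
open Literature.Computability.Complexity.Brick

namespace Summit.QuantumAdvantage.QuantumAdvantage.Theorems

open Summit.QuantumAdvantage.QuantumAdvantage.Theses.RegulatorThird

/- **The refuted target, verbatim, as a local notation.** The route decl `Theses.RegulatorThird.ThirdNotBPP`
(stmt-QuantumAdvantage-15712, refuted-misstated by the theorem below) was replaced at route rev 2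
(2026-08-16T17:00Z) by the corrected `ThirdNotBPPR`; no constant of the old name exists any more. The
token is a LOCAL notation for the refuted item's statement, copied from its ledger signature: the
language THIRD — pairs `⟨bin D, w⟩`, `D > 1` non-square, `w` a prefix of the code of the least triple
`(A, B, n)` whose class `(A + B·α)/n` lies in `u·K³ ∪ u⁻¹·K³` for the fundamental unit `u` of `ℚ(√s)`,
`s` the square-free kernel of `D`, with the cube-class clause `∃ z : K, (… ∨ …)` WITHOUT `z ≠ 0` — is not
in `BPP`. (`quotPrecheck` is off for this one command only: the binder notations have no precheck
handler; every name in the body is fully qualified.) -/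
set_option quotPrecheck false in
local notation "ThirdNotBPP" =>
  ({x : List Bool | ∃ (D n : ℕ) (w : List Bool) (A B : ℤ), x = Literature.Computability.Complexity.boolPair (Computability.encodeNat D) w ∧ ¬ IsSquare D ∧ 1 < D ∧ ((∀ s f : ℕ, D = f ^ 2 * s → Squarefree s → (0 < n ∧ ∀ (K : Type) [Field K] [NumberField K], Module.finrank ℚ K = 2 → ∀ α : K, α ^ 2 = (s : K) → ∀ u : (NumberField.RingOfIntegers K)ˣ, (∀ v : (NumberField.RingOfIntegers K)ˣ, ∃ m : ℤ, v = u ^ m ∨ v = -(u ^ m)) → ∃ z : K, ((A : K) + (B : K) * α) / (n : K) = ((u : NumberField.RingOfIntegers K) : K) * z ^ 3 ∨ ((A : K) + (B : K) * α) / (n : K) = ((u⁻¹ : (NumberField.RingOfIntegers K)ˣ) : NumberField.RingOfIntegers K) * z ^ 3)) ∧ ∀ (A' B' : ℤ) (n' : ℕ), (∀ s f : ℕ, D = f ^ 2 * s → Squarefree s → (0 < n' ∧ ∀ (K : Type) [Field K] [NumberField K], Module.finrank ℚ K = 2 → ∀ α : K, α ^ 2 = (s : K) → ∀ u : (NumberField.RingOfIntegers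 K)ˣ, (∀ v : (NumberField.RingOfIntegers K)ˣ, ∃ m : ℤ, v = u ^ m ∨ v = -(u ^ m)) → ∃ z : K, ((A' : K) + (B' : K) * α) / (n' : K) = ((u : NumberField.RingOfIntegers K) : K) * z ^ 3 ∨ ((A' : K) + (B' : K) * α) / (n' : K) = ((u⁻¹ : (NumberField.RingOfIntegers K)ˣ) : NumberField.RingOfIntegers K) * z ^ 3)) → (|A| + |B| + n < |A'| + |B'| + n' ∨ (|A| + |B| + n = |A'| + |B'| + n' ∧ (A < A' ∨ (A = A' ∧ (B < B' ∨ (B = B' ∧ n ≤ n'))))))) ∧ w <+: Literature.Computability.Complexity.boolPair (Literature.Computability.Complexity.boolPair (Computability.encodeNat A.natAbs) (Computability.encodeNat B.natAbs)) (Literature.Computability.Complexity.boolPair (Computability.encodeNat n) [decide (A < 0), decide (B < 0)])} ∉ Literature.Computability.Complexity.BPP)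

/-- Refutes `RegulatorThird.ThirdNotBPP` [refuted-misstated]: the representative clause
`∃ z : K, (A + Bα)/n = u z³ ∨ … = u⁻¹ z³` admits `z = 0`, so `(A*, B*, n*) = (0, 0, 1)` for every
`D` and THIRD `= {⟨bin D, w⟩ : ¬ IsSquare D ∧ 1 < D ∧ w <+: code(0,0,1)} ∈ P ⊆ BPP`; witness
`(A, B, n, z) = (0, 0, 1, 0)`; repaired: require `z ≠ 0` in the clause (the witness then misses
it). [folklore] -/
theorem RegulatorThirdThirdNotBPP_refuted : ¬ ThirdNotBPP := by
  classical
  /- 1. Five polynomial-time tests on a raw string `x`. -/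
  have pairLang : ({x | boolPair (fstP x) (sndP x) = x} : Language Bool) ∈ Classes.P :=
    setOf_mem_P_of_decide (g := eqPairFn ∘ fanoutFn (fanoutFn fstP sndP) id)
      (comp_mem_FP eqPairFn_mem_FP
        (fanoutFn_mem_FP (fanoutFn_mem_FP fstP_mem_FP sndP_mem_FP) OracleCompose.id_mem_FP))
      _ (fun x => by simp [eqPairFn_boolPair])
  have canonLang : ({x | fstP x = encodeNat (bitsToNat (fstP x))} : Language Bool) ∈ Classes.P :=
    setOf_mem_P_of_decide (g := eqPairFn ∘ fanoutFn fstP (norm ∘ fstP))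
      (comp_mem_FP eqPairFn_mem_FP
        (fanoutFn_mem_FP fstP_mem_FP (comp_mem_FP norm_mem_FP fstP_mem_FP)))
      _ (fun x => by simp [eqPairFn_boolPair, norm_eq_encodeNat])
  have sqrtFst : ((fun w => encodeNat (Nat.sqrt (bitsToNat w))) ∘ fstP) ∈ FP :=
    comp_mem_FP natSqrt_mem_FP fstP_mem_FP
  have nsqLang : ({x | Nat.sqrt (bitsToNat (fstP x)) * Nat.sqrt (bitsToNat (fstP x)) <
      bitsToNat (fstP x)} : Language Bool) ∈ Classes.P :=
    setOf_mem_P_of_decide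
      (g := ltFn ∘ fanoutFn (prodFn ∘ fanoutFn ((fun w => encodeNat (Nat.sqrt (bitsToNat w))) ∘ fstP)
        ((fun w => encodeNat (Nat.sqrt (bitsToNat w))) ∘ fstP)) fstP)
      (comp_mem_FP ltFn_mem_FP
        (fanoutFn_mem_FP (comp_mem_FP prodFn_mem_FP (fanoutFn_mem_FP sqrtFst sqrtFst)) fstP_mem_FP))
      _ (fun x => by simp [ltFn_boolPair, prodFn_boolPair, bitsToNat_encodeNat])
  have gt1Lang : ({x | 1 < bitsToNat (fstP x)} : Language Bool) ∈ Classes.P :=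
    setOf_mem_P_of_decide (g := ltFn ∘ fanoutFn (fun _ => encodeNat 1) fstP)
      (comp_mem_FP ltFn_mem_FP (fanoutFn_mem_FP (const_mem_FP _) fstP_mem_FP))
      _ (fun x => by simp [ltFn_boolPair, bitsToNat_encodeNat])
  have eqSndLang : ∀ t : List Bool, ({x | sndP x = t} : Language Bool) ∈ Classes.P := fun t =>
    setOf_mem_P_of_decide (g := eqPairFn ∘ fanoutFn sndP (fun _ => t))
      (comp_mem_FP eqPairFn_mem_FP (fanoutFn_mem_FP sndP_mem_FP (const_mem_FP t)))
      _ (fun x => by simp [eqPairFn_boolPair])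
  have memListLang : ∀ l : List (List Bool), ({x | sndP x ∈ l} : Language Bool) ∈ Classes.P := by
    intro l
    induction l with
    | nil =>
      exact setOf_mem_P_of_decide (const_mem_FP [false]) (fun x => sndP x ∈ ([] : List (List Bool)))
        (fun _ => by simp)
    | cons t l ih =>
      exact mem_P_of_iff (union_mem_P (eqSndLang t) ih) _ (fun w => by
        show sndP w ∈ t :: l ↔ w ∈ ({x | sndP x = t} : Language Bool) ∨ w ∈ ({x | sndP x ∈ l} : Language Bool)
        simp [List.mem_cons])
  have prefLang : ∀ c : List Bool, ({x | sndP x <+: c} : Language Bool) ∈ Classes.P := fun c =>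
    mem_P_of_iff (memListLang c.inits) _ (fun w => by
      show sndP w <+: c ↔ sndP w ∈ c.inits
      rw [List.mem_inits])
  /- 2. `¬ IsSquare D ↔ ⌊√D⌋² < D`. -/
  have not_isSquare_iff : ∀ n : ℕ, ¬ IsSquare n ↔ Nat.sqrt n * Nat.sqrt n < n := by
    intro n
    have hle : Nat.sqrt n * Nat.sqrt n ≤ n := Nat.sqrt_le n
    constructor
    · intro h
      exact lt_of_le_of_ne hle fun h' => h ⟨Nat.sqrt n, h'.symm⟩
    · rintro hlt ⟨r, hr⟩
      subst hr
      rw [Nat.sqrt_eq] at hlt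
      exact lt_irrefl _ hlt
  /- 3. Every `D` is `f² · s` with `s` squarefree (so the rep clause is never vacuous). -/
  have exists_sq_mul_squarefree : ∀ D : ℕ, ∃ s f : ℕ, D = f ^ 2 * s ∧ Squarefree s := by
    intro D
    obtain ⟨a, b, h, ha⟩ := Nat.sq_mul_squarefree D
    exact ⟨a, b, h.symm, ha⟩
  /- 4. THE JUNK: `z = 0` makes `(0, 0, 1)` a representative in every quadratic field. -/
  have rep001 : ∀ (K : Type) [Field K] [NumberField K] (α : K) (u : (NumberField.RingOfIntegers K)ˣ),
      ∃ z : K, (((0 : ℤ) : K) + ((0 : ℤ) : K) * α) / ((1 : ℕ) : K) =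
          ((u : NumberField.RingOfIntegers K) : K) * z ^ 3 ∨
        (((0 : ℤ) : K) + ((0 : ℤ) : K) * α) / ((1 : ℕ) : K) =
          ((u⁻¹ : (NumberField.RingOfIntegers K)ˣ) : NumberField.RingOfIntegers K) * z ^ 3 :=
    fun K _ _ α u => ⟨0, Or.inl (by simp)⟩
  have habs0 : |(0 : ℤ)| = 0 := abs_zero
  /- 5. THIRD ∈ BPP, contradicting the hypothesis. -/
  intro h
  apply h
  refine P_subset_BPP_holds (mem_P_of_iff
    (inter_mem_P pairLang (inter_mem_P canonLang (inter_mem_P nsqLang (inter_mem_P gt1Lang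
      (prefLang (boolPair (boolPair (encodeNat (0 : ℤ).natAbs) (encodeNat (0 : ℤ).natAbs))
        (boolPair (encodeNat 1) [decide ((0 : ℤ) < 0), decide ((0 : ℤ) < 0)])))))))
    _ (fun x => ?_))
  show _ ↔ boolPair (fstP x) (sndP x) = x ∧ fstP x = encodeNat (bitsToNat (fstP x)) ∧
    Nat.sqrt (bitsToNat (fstP x)) * Nat.sqrt (bitsToNat (fstP x)) < bitsToNat (fstP x) ∧
    1 < bitsToNat (fstP x) ∧ sndP x <+: boolPair (boolPair (encodeNat (0 : ℤ).natAbs)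
      (encodeNat (0 : ℤ).natAbs)) (boolPair (encodeNat 1) [decide ((0 : ℤ) < 0), decide ((0 : ℤ) < 0)])
  constructor
  · rintro ⟨D, n, w, A, B, rfl, hsq, hD, ⟨hrep, hmin⟩, hw⟩
    -- the squarefree decomposition of `D` exists, so the rep clause gives `0 < n`
    obtain ⟨s, f, hsf, hs⟩ := exists_sq_mul_squarefree D
    have hn : 0 < n := (hrep s f hsf hs).1
    -- minimality against the junk representative `(0, 0, 1)` forces `(A, B, n) = (0, 0, 1)`
    have hkey := hmin 0 0 1 (fun s' f' _ _ => ⟨Nat.one_pos, fun K _ _ _ α _ u _ => rep001 K α u⟩)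
    have a0 := abs_nonneg A; have b0 := abs_nonneg B
    have a1 := le_abs_self A; have a2 := neg_abs_le A
    have b1 := le_abs_self B; have b2 := neg_abs_le B
    have hA : A = 0 := by rcases hkey with h | ⟨h, -⟩ <;> omega
    have hB : B = 0 := by rcases hkey with h | ⟨h, -⟩ <;> omega
    have hn1 : n = 1 := by rcases hkey with h | ⟨h, -⟩ <;> omega
    subst hA hB hn1
    refine ⟨?_, ?_, ?_, ?_, ?_⟩
    · simp
    · simp [bitsToNat_encodeNat]
    · simpa [bitsToNat_encodeNat] using (not_isSquare_iff D).1 hsq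
    · simpa [bitsToNat_encodeNat] using hD
    · simpa using hw
  · rintro ⟨hp, hc, hsq, hD, hw⟩
    refine ⟨bitsToNat (fstP x), 1, sndP x, 0, 0, ?_, (not_isSquare_iff _).2 hsq, hD, ⟨?_, ?_⟩, hw⟩
    · rw [← hc]; exact hp.symm
    · intro s f _ _
      exact ⟨Nat.one_pos, fun K _ _ _ α _ u _ => rep001 K α u⟩
    · intro A' B' n' h'
      obtain ⟨s, f, hsf, hs⟩ := exists_sq_mul_squarefree (bitsToNat (fstP x))
      have hn' : 0 < n' := (h' s f hsf hs).1
      have a0 := abs_nonneg A'; have b0 := abs_nonneg B'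
      have a1 := le_abs_self A'; have a2 := neg_abs_le A'
      have b1 := le_abs_self B'; have b2 := neg_abs_le B'
      by_cases hlt : |(0 : ℤ)| + |(0 : ℤ)| + ((1 : ℕ) : ℤ) < |A'| + |B'| + (n' : ℤ)
      · exact Or.inl hlt
      · right
        have hA' : A' = 0 := by omega
        have hB' : B' = 0 := by omega
        subst hA' hB'
        exact ⟨by omega, Or.inr ⟨rfl, Or.inr ⟨rfl, by omega⟩⟩⟩

end Summit.QuantumAdvantage.QuantumAdvantage.Theorems
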